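import Summits.BirchSwinnertonDyer.BirchSwinnertonDyer.Theorems.EisensteinPrimesBSDpOnCellCStubC3MultMuLemma
import Summits.BirchSwinnertonDyer.BirchSwinnertonDyer.Theorems.EisensteinPrimesFSideCorankLeOffP
import HarnessLib

/-!
# Crux 4 `BSDpOnCellC` (stmt-BirchSwinnertonDyer-19034), line b1: the IMPRIMITIVE CUT of the wall —
# `λ(𝓛^BDP_𝔭) ≤ λ(X_ac^∅ strict at 𝔭̄)` at every X2c datum from [Keller–Yin Lemma 5.1.1, named] +
# [the f-side `S`-relaxation `≤`, KERNEL at `p ‖ N` (p620653)] + [ONE inline input at the imprimitive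
# level: `λ(𝓛) + Σ_{w∈S} λ(𝒫_w(f)) ≤ λ(𝔛^S_f)`] (cell `bsd-eis`, seat `bsd-line-x2-p2` gen 3, D-0154
# KEY row 5; route `EisensteinPrimes`; companions p620653, p621903, p622336, p564629, p613384)

HONEST FRAMING (cell `bsd-eis`, run/shared/lean/pub/bsd-eis/): kernel bookkeeping + composition;
CONDITIONAL on hypothesis-shaped inputs (ONE unrefereed named claim `lemma511_…_OPEN`, inline
imprimitive counts); nothing about any curve is asserted; nothing booked; X2 stays
CONSTRUCTION-SHAPED; no label or count moves; BSD and the main conjectures are proved for NO curve.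
Helper `--supports stmt-BirchSwinnertonDyer-19034`; closes no registered stub (v10: `stub_publishedFacts`,
`stub_c3`, `stub_mazurMC_cellB`); it proves, CONDITIONALLY, the signature of the DRAFT re-cut v11's
`stub_lambdaLowerBound` (sha256 7a228e3b…, evidence #45).

## Why (Keller–Yin's own starting point, arXiv:2402.12781v2 §0.2 L246: "`Char(𝔛^S_f)Λ^nr = (𝓛^S_f)`";
## §5.1 Lemma 5.1.2, L1757: the IMPRIMITIVE main conjecture is what the Hida argument delivers)

The wall on line b1 (seat g2's RESIDUAL-MAP §A/§C) is the Eisenstein-congruence direction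
`λ(𝓛^BDP_𝔭) ≤ λ(X_ac^∅ strict at 𝔭̄)` at every X2c datum. Keller–Yin reach the primitive statement
from the `S`-IMPRIMITIVE one (`S = Σ ∖ {v, v̄, ∞}`) by the two `S`-relaxation comparisons:
algebraic (`λ(𝔛^S_f) = λ(𝔛_f) + Σ_{w∈S} λ(𝒫_w(f))`, Thm. 1.5.1 "whose proof still works in the
multiplicative reduction setting", L1775) and analytic (`𝓛^S_f := 𝓛_f · ∏_{w∈S} 𝒫_w(f)`, L267–268 /
Thm. 2.2.2 `anacong`). Of the algebraic comparison only the INEQUALITY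
`λ(𝔛^S_f) ≤ λ(𝔛_f) + Σ_{w∈S} λ(𝒫_w(f))` is needed for the wall, and THAT is kernel at `p ‖ N`:
`λ(X^{Sf}) = λ(X^∅) + corank(Sel^{Sf}/Sel^∅)` (p564629) and `corank ≤ Σ_{w∈Sf} curveLocalLambda`
(p620653, this seat: the f-side `≤` WITHOUT `p ∤ N`). Hence:

* §1 `le_lambdaInvariant_empty_of_imprimitiveCount` — KERNEL: for `E ×_ℚ K`, odd `p`, `K` imaginary
  quadratic with (Heeg) for `N_E`, `κ` anticyclotomic, any `𝔭`, `Sf` = places over `N_E` off `p`: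
  if `X^{Sf}` is torsion with `μ = 0` and `m + Σ_{w∈Sf} curveLocalLambda ≤ λ(X^{Sf})`, then
  `m ≤ λ(X^∅)` (and `X^∅` torsion, `μ(X^∅) = 0`).
* §2 **`stub_lambdaLowerBound_of_lemma511_OPEN_of_imprimitiveCount`** — the v11-draft stub
  `stub_lambdaLowerBound` VERBATIM (both signs: ∀ X2c datum, ∀ m, `Q` fuc at `m` ⟹ `m ≤ λ(X_ac^∅)`)
  from `KellerYin2024.lemma511_imprimitive_isTorsion_muInvariant_eq_zero_mult_OPEN` (p621903; supplies
  torsion + `μ = 0` of `X^{Sf}`) and the INLINE imprimitive count «∀ Sf = places over `N_E` off `p`,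
  ∀ m, `Q` fuc at `m` ⟹ `m + Σ_{w∈Sf} curveLocalLambda κ E_K w ≤ λ(X^{Sf})`» at every datum, each sign
  — in print's currency `λ(𝓛^S_f) ≤ λ(𝔛^S_f)` (`λ(𝒫_w(f)) = curveLocalLambda`, the tree's D3
  dictionary `KellerYin2024.curveLocalLambda`), the `λ`-consequence of Keller–Yin **Lemma 5.1.2**
  (`Char(𝔛^S_f)Λ^nr = (𝓛^S_f)`, L1757–1769; PREPRINT, printed proof GAPPED at L1754 — kernel
  counterexample `X2.KellerYinFreePartGap`, flag `KYD-gap` of `MultiplicativeReduction.lean`) given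
  Lemma 5.1.1; NOT a new named fact (the datum frame `Q ∈ 𝓞_{ℂ_p}⟦T⟧` is Hsieh's receptacle, for which
  no `𝓛^S` object exists in the tree), hence inline.

EFFECT on the b1 residual (RESIDUAL-MAP §A): «μ(X_ac^∅) = 0, μ(𝓛) = 0, λ(𝓛) ≤ λ(X_ac^∅)» per datum
becomes [KY Lemma 5.1.1, NAMED] + «μ(𝓛) = 0» + «λ(𝓛) + Σ_S λ𝒫_w(f) ≤ λ(𝔛^S_f)» with the f-side
`S`-relaxation DISCHARGED in the kernel — the crux-4 twin of line `halves` v15 → v16 on crux 2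
(`stub_fSideCorankLe` closed by p618030).

References: [KellerYin2024] §0.2 (L246, L255–268), Thm. 1.5.1, Lemma 5.1.1 (L1744–1749), Lemma 5.1.2
(L1750–1769), Thm. 5.1.3 (L1771–1780); [GreenbergVatsal2000] §2 Prop. (2.4), Cor. (2.3);
[Castella2018] Def. 2.2; cell: p613384, p620653, p621903, p622336, RESIDUAL-MAP-crux4-b1.md.
-/

set_option autoImplicit false
set_option linter.dupNamespace false -- the summit namespace `…BirchSwinnertonDyer.BirchSwinnertonDyer.Theorems` (Sub = Summit, D-0017) trips it

noncomputable section

open scoped Classical MatrixGroups ModularForm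

open CongruenceSubgroup WeierstrassCurve NumberField IsDedekindDomain Field PowerSeries
  Literature.NumberTheory.EllipticCurves Literature.NumberTheory.EllipticCurves.GreenbergSelmer
  Literature.NumberTheory.EllipticCurves.ModularForms
  Literature.NumberTheory.EllipticCurves.Rank1Residual
  Literature.NumberTheory.EllipticCurves.Rank1Residual.Typed
  Literature.NumberTheory.GaloisRepresentations Literature.NumberTheory.GaloisCohomology
  Literature.NumberTheory.Automorphic
  Summit.BirchSwinnertonDyer.Rank1Residual.X11b.AcSelmer
  Summit.BirchSwinnertonDyer.Rank1Residual.X11b.Halves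
  Summit.BirchSwinnertonDyer.Rank1Residual.X11b
  Summit.BirchSwinnertonDyer.Rank1Residual Summit.BirchSwinnertonDyer.Rank1Residual.X2
  Summit.BirchSwinnertonDyer.BirchSwinnertonDyer.Theorems
open Literature.NumberTheory.EllipticCurves.KellerYin2024
  (curveLocalLambda lemma511_imprimitive_isTorsion_muInvariant_eq_zero_mult_OPEN)

namespace Summit.BirchSwinnertonDyer.BirchSwinnertonDyer.Theorems.StubC3ImprimitiveCut

/-! ### §1 Kernel: the imprimitive count descends to the primitive `λ` -/

section Kernel

variable {K : Type} [Field K] [NumberField K] {p : ℕ} [Fact p.Prime]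

/-- **The imprimitive count descends: `m + Σ_{w∈Sf} curveLocalLambda ≤ λ(X^{Sf})` ⟹ `m ≤ λ(X^∅)`**
(Castella's duals `X^{Σ} = X_ac^Σ(E_K[p^∞])` strict at `𝔭`; `E/ℚ` globally minimal, `p` odd — good
OR bad —, `K` imaginary quadratic with the Heegner hypothesis for `N_E`, `κ` anticyclotomic with
topological generator `γ`, `Sf` = the places of `K` over `N_E` NOT over `p`; `X^{Sf}` torsion with
`μ = 0`). Also returns the torsion and `μ(X^∅) = 0` of the primitive dual. Proof:
`λ(X^{Sf}) = λ(X^∅) + corank_{ℤ_p}(Sel^{Sf}/Sel^∅)` (p564629) and `corank ≤ Σ_{w∈Sf} curveLocalLambda`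
(p620653), then arithmetic. This is the `≤` half of Keller–Yin Thm. 1.5.1's `S`-relaxation step for
`f`, in the kernel at a multiplicative Eisenstein prime.
[cite: KellerYin2024, proof of Thm. 1.5.1 (arXiv:2402.12781v2 TeX L1358–1360) and Thm. 5.1.3 proof (L1775)]
[cite: GreenbergVatsal2000, §2 Prop. (2.4) and Cor. (2.3) (pp. 20–23)] [cite: Castella2018, Def. 2.2] -/
theorem le_lambdaInvariant_empty_of_imprimitiveCount
    (W : WeierstrassCurve ℚ) [W.IsElliptic] [W.IsGloballyMinimal]
    (hp2 : 2 < p) (hK : IsImaginaryQuadratic K) (hH : SatisfiesHeegnerHypothesis (W.conductorNorm ℤ) K)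
    (κ : ZpExtension K p) (hκ : κ.IsAnticyclotomic) (γ : absoluteGaloisGroup K)
    [hγ : Fact (κ.IsTopGenerator γ)] (𝔭 : HeightOneSpectrum (𝓞 K)) (Sf : Finset (HeightOneSpectrum (𝓞 K)))
    (hSf : ∀ w : HeightOneSpectrum (𝓞 K), w ∈ Sf ↔
      (((W.conductorNorm ℤ : ℤ) : 𝓞 K) ∈ w.asIdeal ∧ ((p : ℕ) : 𝓞 K) ∉ w.asIdeal))
    (htor : Module.IsTorsion (IwasawaAlgebra p)
      (Castella2018.AcSelmer.XAc (W.baseChange K) p κ 𝔭 (↑Sf : Set (HeightOneSpectrum (𝓞 K))) γ))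
    (hμ : muInvariant p
      (Castella2018.AcSelmer.XAc (W.baseChange K) p κ 𝔭 (↑Sf : Set (HeightOneSpectrum (𝓞 K))) γ) = 0)
    {m : ℕ}
    (hcount : m + ∑ w ∈ Sf, curveLocalLambda κ (W.baseChange K) w ≤
      lambdaInvariant p
        (Castella2018.AcSelmer.XAc (W.baseChange K) p κ 𝔭 (↑Sf : Set (HeightOneSpectrum (𝓞 K))) γ)) :
    Module.IsTorsion (IwasawaAlgebra p) (Castella2018.AcSelmer.XAc (W.baseChange K) p κ 𝔭 ∅ γ) ∧
      muInvariant p (Castella2018.AcSelmer.XAc (W.baseChange K) p κ 𝔭 ∅ γ) = 0 ∧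
      m ≤ lambdaInvariant p (Castella2018.AcSelmer.XAc (W.baseChange K) p κ 𝔭 ∅ γ) := by
  haveI : (W.baseChange K).IsElliptic := by rw [WeierstrassCurve.baseChange]; infer_instance
  obtain ⟨htor₀, hμ₀, hlam⟩ :=
    StubC3MultMuLemma.isTorsion_muInvariant_eq_zero_empty_of_imprimitive (W.baseChange K) κ 𝔭 γ Sf
      htor hμ
  have hcork := FSideCorankLeOffP.zpCorank_selmerAc_quotient_le_sum_curveLocalLambda_of_offP_iff W hp2
    hK hH κ hκ hγ.out 𝔭 Sf hSf
  refine ⟨htor₀, hμ₀, ?_⟩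
  rw [hlam] at hcount
  omega

end Kernel

/-! ### §2 The v11-draft stub `stub_lambdaLowerBound` VERBATIM, from Lemma 5.1.1 + the imprimitive count -/

/-- **`stub_lambdaLowerBound` (re-cut draft b1 v11) from Keller–Yin Lemma 5.1.1 BY NAME and the INLINE
imprimitive count, both signs.** Hypotheses: `h511` (p621903; torsion + `μ = 0` of `X^{Sf}`);
`hcountN` / `hcountS` = at every X2c datum of each sign, for `Sf` = the places of `K` over `N_E` off `p`
and every `m` at which the ♭-frame `Q` has its first unit coefficient,
`m + Σ_{w∈Sf} curveLocalLambda κ E_K w ≤ λ(X_ac^{Sf} strict at 𝔭̄)` — print's `λ(𝓛^S_f) ≤ λ(𝔛^S_f)`,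
the `λ`-consequence of Keller–Yin Lemma 5.1.2 (PREPRINT, gapped-as-printed at L1754). Conclusion:
∀ datum ∀ m, `Q` fuc at `m` ⟹ `m ≤ λ(X_ac^∅ strict at 𝔭̄)` (X-slot = `XAc (W.baseChange K) p κ 𝔭bar ∅ γ`).
From the datum: `CellC` ⇒ `p ≠ 2`, `Red`, `Mult`; `d_K < −4` ⇒ `d_K ≠ −3`; `N = N_E`; `Sf` by
`StubC3MultMuLemma.exists_finset_offP`; then §1. CONDITIONAL; nothing booked; closes no v10 stub.
[claim: KellerYin2024, status: under-review]
[cite: KellerYin2024, Lemma 5.1.1 (L1744–1749), Lemma 5.1.2 (L1750–1769), §0.2 L246 and L267–268 (arXiv:2402.12781v2) (shape only)]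
[cite: GreenbergVatsal2000, §2 Prop. (2.4)] [cite: Castella2018, Def. 2.2] -/
theorem stub_lambdaLowerBound_of_lemma511_OPEN_of_imprimitiveCount
    (h511 : lemma511_imprimitive_isTorsion_muInvariant_eq_zero_mult_OPEN)
    (hcountN :
      ∀ (W : WeierstrassCurve ℚ) [W.IsElliptic] [W.IsGloballyMinimal] (p : ℕ) [Fact p.Prime],
        ∀ (N : ℕ) [NeZero N] (K : Type) [Field K] [NumberField K] (Dt : ModularParametrizationData W N)
          (H : HeegnerDatum N (NumberField.discr K)) (ιK : K →+* ℂ) (P : (W.baseChange K).toAffine.Point),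
          CellC W p → ¬ W.HasSplitMultiplicativeReductionAtPrime p → W.conductorNorm ℤ = N →
          IsImaginaryQuadratic K → NumberField.discr K < -4 → SatisfiesHeegnerHypothesis N K →
          (W.quadraticTwist (NumberField.discr K : ℚ)).entireLFunction 1 ≠ 0 →
          WeierstrassCurve.Affine.Point.map ιK.toRatAlgHom P = heegnerPointComplex Dt H →
          ¬ (p : ℤ) ∣ Dt.c → ¬ IsOfFinAddOrder P →
          Odd (NumberField.discr K) →
          ∀ (κ : ZpExtension K p), κ.IsAnticyclotomic →
            ∀ (γ : Field.absoluteGaloisGroup K) [Fact (κ.IsTopGenerator γ)]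
              (𝔭 : HeightOneSpectrum (𝓞 K)), ((p : ℕ) : 𝓞 K) ∈ 𝔭.asIdeal →
              𝔭.asIdeal.ramificationIdx (𝓞 ℚ) = 1 → 𝔭.asIdeal.inertiaDeg (𝓞 ℚ) = 1 →
              ∀ (𝔭bar : HeightOneSpectrum (𝓞 K)), ((p : ℕ) : 𝓞 K) ∈ 𝔭bar.asIdeal → 𝔭bar ≠ 𝔭 →
                ((Ideal.span {(p : ℤ)}).primesOver (𝓞 K)).ncard = 2 →
              ∀ (f : CuspForm (CongruenceSubgroup.Gamma0 N) 2), IsNewformOf W f →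
                ∀ (ι' : PadicAlgCl p ≃+* ℂ),
                  (∀ (w : InfinitePlace K) (k : 𝓞 K),
                    k ∈ 𝔭.asIdeal ↔ ‖ι'.symm (w.embedding (k : K))‖ < 1) →
                  ∀ (ΩK : ℂ) (Ωp : ℂ_[p]) (Q : PowerSeries 𝓞_ℂ_[p]), ΩK ≠ 0 → ‖Ωp‖ = 1 →
                    R1.IsBDPLFunctionInt p ι' 𝔭 κ γ f ΩK Ωp Q →
                      ∀ (Sf : Finset (HeightOneSpectrum (𝓞 K))),
                        (∀ w : HeightOneSpectrum (𝓞 K), w ∈ Sf ↔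
                          (((W.conductorNorm ℤ : ℤ) : 𝓞 K) ∈ w.asIdeal ∧ ((p : ℕ) : 𝓞 K) ∉ w.asIdeal)) →
                        ∀ m : ℕ, ‖((PowerSeries.coeff m Q : 𝓞_ℂ_[p]) : ℂ_[p])‖ = 1 →
                          (∀ i < m, ‖((PowerSeries.coeff i Q : 𝓞_ℂ_[p]) : ℂ_[p])‖ < 1) →
                            m + ∑ w ∈ Sf, curveLocalLambda κ (W.baseChange K) w ≤
                              lambdaInvariant p (XAc (W.baseChange K) p κ 𝔭bar (↑Sf : Set (HeightOneSpectrum (𝓞 K))) γ))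
    (hcountS :
      ∀ (W : WeierstrassCurve ℚ) [W.IsElliptic] [W.IsGloballyMinimal] (p : ℕ) [Fact p.Prime],
        ∀ (N : ℕ) [NeZero N] (K : Type) [Field K] [NumberField K] (Dt : ModularParametrizationData W N)
          (H : HeegnerDatum N (NumberField.discr K)) (ιK : K →+* ℂ) (P : (W.baseChange K).toAffine.Point),
          CellC W p → W.HasSplitMultiplicativeReductionAtPrime p → W.conductorNorm ℤ = N →
          IsImaginaryQuadratic K → NumberField.discr K < -4 → SatisfiesHeegnerHypothesis N K →
          (W.quadraticTwist (NumberField.discr K : ℚ)).entireLFunction 1 ≠ 0 →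
          WeierstrassCurve.Affine.Point.map ιK.toRatAlgHom P = heegnerPointComplex Dt H →
          ¬ (p : ℤ) ∣ Dt.c → ¬ IsOfFinAddOrder P →
          Odd (NumberField.discr K) →
          ∀ (κ : ZpExtension K p), κ.IsAnticyclotomic →
            ∀ (γ : Field.absoluteGaloisGroup K) [Fact (κ.IsTopGenerator γ)]
              (𝔭 : HeightOneSpectrum (𝓞 K)), ((p : ℕ) : 𝓞 K) ∈ 𝔭.asIdeal →
              𝔭.asIdeal.ramificationIdx (𝓞 ℚ) = 1 → 𝔭.asIdeal.inertiaDeg (𝓞 ℚ) = 1 →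
              ∀ (𝔭bar : HeightOneSpectrum (𝓞 K)), ((p : ℕ) : 𝓞 K) ∈ 𝔭bar.asIdeal → 𝔭bar ≠ 𝔭 →
                ((Ideal.span {(p : ℤ)}).primesOver (𝓞 K)).ncard = 2 →
              ∀ (f : CuspForm (CongruenceSubgroup.Gamma0 N) 2), IsNewformOf W f →
                ∀ (ι' : PadicAlgCl p ≃+* ℂ),
                  (∀ (w : InfinitePlace K) (k : 𝓞 K),
                    k ∈ 𝔭.asIdeal ↔ ‖ι'.symm (w.embedding (k : K))‖ < 1) →
                  ∀ (ΩK : ℂ) (Ωp : ℂ_[p]) (Q : PowerSeries 𝓞_ℂ_[p]), ΩK ≠ 0 → ‖Ωp‖ = 1 →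
                    R1.IsBDPLFunctionInt p ι' 𝔭 κ γ f ΩK Ωp Q →
                      ∀ (Sf : Finset (HeightOneSpectrum (𝓞 K))),
                        (∀ w : HeightOneSpectrum (𝓞 K), w ∈ Sf ↔
                          (((W.conductorNorm ℤ : ℤ) : 𝓞 K) ∈ w.asIdeal ∧ ((p : ℕ) : 𝓞 K) ∉ w.asIdeal)) →
                        ∀ m : ℕ, ‖((PowerSeries.coeff m Q : 𝓞_ℂ_[p]) : ℂ_[p])‖ = 1 →
                          (∀ i < m, ‖((PowerSeries.coeff i Q : 𝓞_ℂ_[p]) : ℂ_[p])‖ < 1) →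
                            m + ∑ w ∈ Sf, curveLocalLambda κ (W.baseChange K) w ≤
                              lambdaInvariant p (XAc (W.baseChange K) p κ 𝔭bar (↑Sf : Set (HeightOneSpectrum (𝓞 K))) γ)) :
    (∀ (W : WeierstrassCurve ℚ) [W.IsElliptic] [W.IsGloballyMinimal] (p : ℕ) [Fact p.Prime],
      ∀ (N : ℕ) [NeZero N] (K : Type) [Field K] [NumberField K] (Dt : ModularParametrizationData W N)
        (H : HeegnerDatum N (NumberField.discr K)) (ιK : K →+* ℂ) (P : (W.baseChange K).toAffine.Point),
        CellC W p → ¬ W.HasSplitMultiplicativeReductionAtPrime p → W.conductorNorm ℤ = N →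
        IsImaginaryQuadratic K → NumberField.discr K < -4 → SatisfiesHeegnerHypothesis N K →
        (W.quadraticTwist (NumberField.discr K : ℚ)).entireLFunction 1 ≠ 0 →
        WeierstrassCurve.Affine.Point.map ιK.toRatAlgHom P = heegnerPointComplex Dt H →
        ¬ (p : ℤ) ∣ Dt.c → ¬ IsOfFinAddOrder P →
        Odd (NumberField.discr K) →
        ∀ (κ : ZpExtension K p), κ.IsAnticyclotomic →
          ∀ (γ : Field.absoluteGaloisGroup K) [Fact (κ.IsTopGenerator γ)]
            (𝔭 : HeightOneSpectrum (𝓞 K)), ((p : ℕ) : 𝓞 K) ∈ 𝔭.asIdeal →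
            𝔭.asIdeal.ramificationIdx (𝓞 ℚ) = 1 → 𝔭.asIdeal.inertiaDeg (𝓞 ℚ) = 1 →
            ∀ (𝔭bar : HeightOneSpectrum (𝓞 K)), ((p : ℕ) : 𝓞 K) ∈ 𝔭bar.asIdeal → 𝔭bar ≠ 𝔭 →
              ((Ideal.span {(p : ℤ)}).primesOver (𝓞 K)).ncard = 2 →
            ∀ (f : CuspForm (CongruenceSubgroup.Gamma0 N) 2), IsNewformOf W f →
              ∀ (ι' : PadicAlgCl p ≃+* ℂ),
                (∀ (w : InfinitePlace K) (k : 𝓞 K),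
                  k ∈ 𝔭.asIdeal ↔ ‖ι'.symm (w.embedding (k : K))‖ < 1) →
                ∀ (ΩK : ℂ) (Ωp : ℂ_[p]) (Q : PowerSeries 𝓞_ℂ_[p]), ΩK ≠ 0 → ‖Ωp‖ = 1 →
                  R1.IsBDPLFunctionInt p ι' 𝔭 κ γ f ΩK Ωp Q →
                    ∀ m : ℕ, ‖((PowerSeries.coeff m Q : 𝓞_ℂ_[p]) : ℂ_[p])‖ = 1 →
                  (∀ i < m, ‖((PowerSeries.coeff i Q : 𝓞_ℂ_[p]) : ℂ_[p])‖ < 1) →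
                    m ≤ lambdaInvariant p (XAc (W.baseChange K) p κ 𝔭bar ∅ γ)) ∧
    (∀ (W : WeierstrassCurve ℚ) [W.IsElliptic] [W.IsGloballyMinimal] (p : ℕ) [Fact p.Prime],
      ∀ (N : ℕ) [NeZero N] (K : Type) [Field K] [NumberField K] (Dt : ModularParametrizationData W N)
        (H : HeegnerDatum N (NumberField.discr K)) (ιK : K →+* ℂ) (P : (W.baseChange K).toAffine.Point),
        CellC W p → W.HasSplitMultiplicativeReductionAtPrime p → W.conductorNorm ℤ = N →
        IsImaginaryQuadratic K → NumberField.discr K < -4 → SatisfiesHeegnerHypothesis N K →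
        (W.quadraticTwist (NumberField.discr K : ℚ)).entireLFunction 1 ≠ 0 →
        WeierstrassCurve.Affine.Point.map ιK.toRatAlgHom P = heegnerPointComplex Dt H →
        ¬ (p : ℤ) ∣ Dt.c → ¬ IsOfFinAddOrder P →
        Odd (NumberField.discr K) →
        ∀ (κ : ZpExtension K p), κ.IsAnticyclotomic →
          ∀ (γ : Field.absoluteGaloisGroup K) [Fact (κ.IsTopGenerator γ)]
            (𝔭 : HeightOneSpectrum (𝓞 K)), ((p : ℕ) : 𝓞 K) ∈ 𝔭.asIdeal →
            𝔭.asIdeal.ramificationIdx (𝓞 ℚ) = 1 → 𝔭.asIdeal.inertiaDeg (𝓞 ℚ) = 1 →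
            ∀ (𝔭bar : HeightOneSpectrum (𝓞 K)), ((p : ℕ) : 𝓞 K) ∈ 𝔭bar.asIdeal → 𝔭bar ≠ 𝔭 →
              ((Ideal.span {(p : ℤ)}).primesOver (𝓞 K)).ncard = 2 →
            ∀ (f : CuspForm (CongruenceSubgroup.Gamma0 N) 2), IsNewformOf W f →
              ∀ (ι' : PadicAlgCl p ≃+* ℂ),
                (∀ (w : InfinitePlace K) (k : 𝓞 K),
                  k ∈ 𝔭.asIdeal ↔ ‖ι'.symm (w.embedding (k : K))‖ < 1) →
                ∀ (ΩK : ℂ) (Ωp : ℂ_[p]) (Q : PowerSeries 𝓞_ℂ_[p]), ΩK ≠ 0 → ‖Ωp‖ = 1 →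
                  R1.IsBDPLFunctionInt p ι' 𝔭 κ γ f ΩK Ωp Q →
                    ∀ m : ℕ, ‖((PowerSeries.coeff m Q : 𝓞_ℂ_[p]) : ℂ_[p])‖ = 1 →
                  (∀ i < m, ‖((PowerSeries.coeff i Q : 𝓞_ℂ_[p]) : ℂ_[p])‖ < 1) →
                    m ≤ lambdaInvariant p (XAc (W.baseChange K) p κ 𝔭bar ∅ γ)) := by
  refine ⟨fun W _ _ p _ N _ K _ _ Dt H ιK P hc hsg hN hK hd4 hHN hLt hP hcM hPinf hodd κ hκ γ _ 𝔭 h𝔭 he hf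
      𝔭bar h𝔭bar hne hsplit f hfW ι' hι' ΩK Ωp Q hΩK hΩp hQ m hm hlt ↦ ?_,
    fun W _ _ p _ N _ K _ _ Dt H ιK P hc hsg hN hK hd4 hHN hLt hP hcM hPinf hodd κ hκ γ _ 𝔭 h𝔭 he hf
      𝔭bar h𝔭bar hne hsplit f hfW ι' hι' ΩK Ωp Q hΩK hΩp hQ m hm hlt ↦ ?_⟩
  · have hp2 : 2 < p := by
      have hp := (Fact.out : p.Prime).two_le
      rcases hp.lt_or_eq with h | h
      · exact h
      · exact absurd h.symm hc.2.1
    have h3 : NumberField.discr K ≠ -3 := by omega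
    have hN0 : W.conductorNorm ℤ ≠ 0 := (W.conductorNorm_pos_holds).ne'
    have hHW : SatisfiesHeegnerHypothesis (W.conductorNorm ℤ) K := hN ▸ hHN
    obtain ⟨Sf, hSf⟩ := StubC3MultMuLemma.exists_finset_offP (K := K) hN0 p
    obtain ⟨htor, hμ⟩ := h511 W K 𝔭bar κ γ Sf hp2 hc.2.2.2 hc.2.2.1 hK hHW hodd h3 hsplit h𝔭bar hκ hSf
    have hc' : m + ∑ w ∈ Sf, curveLocalLambda κ (W.baseChange K) w ≤
        lambdaInvariant p
          (Castella2018.AcSelmer.XAc (W.baseChange K) p κ 𝔭bar (↑Sf : Set (HeightOneSpectrum (𝓞 K))) γ) :=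
      hcountN W p N K Dt H ιK P hc hsg hN hK hd4 hHN hLt hP hcM hPinf hodd κ hκ γ 𝔭 h𝔭 he hf 𝔭bar h𝔭bar
        hne hsplit f hfW ι' hι' ΩK Ωp Q hΩK hΩp hQ Sf hSf m hm hlt
    exact (le_lambdaInvariant_empty_of_imprimitiveCount W hp2 hK hHW κ hκ γ 𝔭bar Sf hSf htor hμ hc').2.2
  · have hp2 : 2 < p := by
      have hp := (Fact.out : p.Prime).two_le
      rcases hp.lt_or_eq with h | h
      · exact h
      · exact absurd h.symm hc.2.1
    have h3 : NumberField.discr K ≠ -3 := by omega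
    have hN0 : W.conductorNorm ℤ ≠ 0 := (W.conductorNorm_pos_holds).ne'
    have hHW : SatisfiesHeegnerHypothesis (W.conductorNorm ℤ) K := hN ▸ hHN
    obtain ⟨Sf, hSf⟩ := StubC3MultMuLemma.exists_finset_offP (K := K) hN0 p
    obtain ⟨htor, hμ⟩ := h511 W K 𝔭bar κ γ Sf hp2 hc.2.2.2 hc.2.2.1 hK hHW hodd h3 hsplit h𝔭bar hκ hSf
    have hc' : m + ∑ w ∈ Sf, curveLocalLambda κ (W.baseChange K) w ≤
        lambdaInvariant p
          (Castella2018.AcSelmer.XAc (W.baseChange K) p κ 𝔭bar (↑Sf : Set (HeightOneSpectrum (𝓞 K))) γ) :=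
      hcountS W p N K Dt H ιK P hc hsg hN hK hd4 hHN hLt hP hcM hPinf hodd κ hκ γ 𝔭 h𝔭 he hf 𝔭bar h𝔭bar
        hne hsplit f hfW ι' hι' ΩK Ωp Q hΩK hΩp hQ Sf hSf m hm hlt
    exact (le_lambdaInvariant_empty_of_imprimitiveCount W hp2 hK hHW κ hκ γ 𝔭bar Sf hSf htor hμ hc').2.2

end Summit.BirchSwinnertonDyer.BirchSwinnertonDyer.Theorems.StubC3ImprimitiveCut

end
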